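import Summits.RiemannHypothesis.RiemannHypothesis.Theses.SpectralTrace
import Summits.RiemannHypothesis.RiemannHypothesis.Theorems.SpectralTraceWindowCompactness

/-!
# Sketch (crux-ideate, stmt-RiemannHypothesis-0187 = `SpectralThesis`, ideator k = 2, round 1)

First lemmas of the two idea cards, typed over existing declarations:

* card `window-continuity-method`: the ladder set `{A : Trace(A)}` is an up-open, limit-closed
  down-set, so `X ⟺ BaseRung ∧ OpenLadder` given `ClosedLadder` (provable by the route's
  compactness argument).  PROVED here: the pure-logic frame
  `spectralThesis_of_continuity : BaseRung → OpenLadder → ClosedLadder → SpectralThesis`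
  (continuity method on `ℝ` + the tree's `windowCompactness_proof`).  The ♯-class (prime-singular
  witnesses) in which openness becomes an implicit-function statement and the crux becomes the
  a-priori collar estimate `UniformCollar` is typed as well.
* card `prime-singular-seed`: `PrimeSingularSeed` — an unconditional real unit-atomic family whose
  defect against the Weil functional is a locally integrable FUNCTION (all Dirac / principal-value
  content of `W` realised exactly); and the normal form `SeedCorrection`.
-/

noncomputable section

namespace Summit.RiemannHypothesis.RiemannHypothesis.Cruxes.SpectralThesis.Ideator2

open Complex Set MeasureTheory
open Literature.NumberTheory.LFunctions
open Summit.RiemannHypothesis.RiemannHypothesis.Theses.SpectralTrace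
open Summit.RiemannHypothesis.RiemannHypothesis.Theorems

/-- The rung `Trace(A)`: some real family reproduces `W` on the Weil tests supported in `[-A, A]`
(literally the hypothesis shape of `WindowCompactness`). -/
def TraceWin (A : ℝ) : Prop :=
  ∃ (ι : Type) (γ : ι → ℝ), ∀ g : ℝ → ℂ, IsWeilTest g → tsupport g ⊆ Icc (-A) A →
    HasSum (fun i => weilMellin g (1 / 2 + (γ i : ℂ) * I)) (weilFunctional g)

/-- Rungs are monotone: a bigger window's witness serves every smaller window. -/
theorem traceWin_mono {A A' : ℝ} (h : A ≤ A') (hA' : TraceWin A') : TraceWin A := by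
  obtain ⟨ι, γ, hγ⟩ := hA'
  exact ⟨ι, γ, fun g hg hgs => hγ g hg (hgs.trans (Icc_subset_Icc (by linarith) h))⟩

/-- BASE: some positive window carries a rung. -/
def BaseRung : Prop := ∃ A₀ : ℝ, 0 < A₀ ∧ TraceWin A₀

/-- OPENNESS (the crux of the continuity method): every rung extends a little. -/
def OpenLadder : Prop := ∀ A : ℝ, 0 < A → TraceWin A → ∃ ε : ℝ, 0 < ε ∧ TraceWin (A + ε)

/-- CLOSEDNESS (provable: Helly/vague compactness of witnesses with the uniform local Weyl bound
`card_near_le_log_of_windowTrace`, integrality of vague limits of unit point measures, tails by the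
decay of `ĝ`, and dilation `g(t/r)`, `r ↑ 1`, for tests touching `±A`). -/
def ClosedLadder : Prop :=
  ∀ A : ℝ, 0 < A → (∀ A' : ℝ, 0 < A' → A' < A → TraceWin A') → TraceWin A

/-- **Continuity method on the window parameter** (pure logic over `ℝ`): base + openness +
closedness give every rung. -/
theorem forall_traceWin_of_continuity (hB : BaseRung) (hO : OpenLadder) (hC : ClosedLadder) :
    ∀ A : ℝ, 0 < A → TraceWin A := by
  intro A hA
  by_contra hnot
  obtain ⟨A₀, hA₀, hT₀⟩ := hB
  set S : Set ℝ := {x | 0 < x ∧ TraceWin x} with hS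
  have hmem₀ : A₀ ∈ S := ⟨hA₀, hT₀⟩
  have hne : S.Nonempty := ⟨A₀, hmem₀⟩
  have hbdd : ∀ x ∈ S, x ≤ A := by
    intro x hx
    by_contra hxA
    push Not at hxA
    exact hnot (traceWin_mono hxA.le hx.2)
  have hBdd : BddAbove S := ⟨A, hbdd⟩
  have hs_pos : 0 < sSup S := lt_of_lt_of_le hA₀ (le_csSup hBdd hmem₀)
  have hTs : TraceWin (sSup S) := by
    refine hC (sSup S) hs_pos ?_
    intro A' _ hA'lt
    obtain ⟨x, hxS, hA'x⟩ := exists_lt_of_lt_csSup hne hA'lt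
    exact traceWin_mono hA'x.le hxS.2
  obtain ⟨ε, hε, hTε⟩ := hO (sSup S) hs_pos hTs
  have hle : sSup S + ε ≤ sSup S := le_csSup hBdd ⟨by linarith, hTε⟩
  linarith

/-- **Frame theorem for the crux**: `BaseRung → OpenLadder → ClosedLadder → X`, through the
tree's `windowCompactness_proof`. -/
theorem spectralThesis_of_continuity (hB : BaseRung) (hO : OpenLadder) (hC : ClosedLadder) :
    SpectralThesis := by
  unfold SpectralThesis
  exact windowCompactness_proof (fun A hA => forall_traceWin_of_continuity hB hO hC A hA)

/-! ### The ♯-class: prime-singular witnesses (card `prime-singular-seed` + the IFT form of openness) -/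

/-- A real family `γ` together with a DEFECT FUNCTION `F`: the family reproduces `W` up to the
locally integrable function `F` on ALL Weil tests (so every Dirac mass `-Λ(n) n^{-1/2} δ_{± log n}`,
the `δ₀`-mass and the `pv 1/|t|` germ of `W` are carried exactly by `Σ_n e^{iγ_n t}`). -/
def IsPrimeSingular (γ : ℕ → ℝ) (F : ℝ → ℂ) : Prop :=
  LocallyIntegrable F ∧ ∀ g : ℝ → ℂ, IsWeilTest g →
    HasSum (fun n => weilMellin g (1 / 2 + (γ n : ℂ) * I)) (weilFunctional g + ∫ t, g t * F t)

/-- **PRIME-SINGULAR SEED (card `prime-singular-seed`, first lemma; unconditional theorem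
candidate)**: such a pair exists — e.g. the phase staircase `θ(γ_n) + π S♯(γ_n) = π(n - 3/2)` of the
Riemann–Siegel theta function modulated by the smoothly truncated prime phase
`S♯(τ) = -(1/π) Σ_{m ≤ c log² τ} Λ(m) m^{-1/2} sin(τ log m)/log m` (monotone by Chebyshev's bound). -/
def PrimeSingularSeed : Prop := ∃ (γ : ℕ → ℝ) (F : ℝ → ℂ), IsPrimeSingular γ F

/-- `Trace♯(A)`: a prime-singular witness whose defect function vanishes on the window. -/
def TraceSharp (A : ℝ) : Prop :=
  ∃ (γ : ℕ → ℝ) (F : ℝ → ℂ), IsPrimeSingular γ F ∧ ∀ t ∈ Icc (-A) A, F t = 0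

/-- A ♯-rung is a rung. -/
theorem traceWin_of_traceSharp {A : ℝ} (h : TraceSharp A) : TraceWin A := by
  obtain ⟨γ, F, ⟨_, hγ⟩, hF⟩ := h
  refine ⟨ℕ, γ, fun g hg hgs => ?_⟩
  have hzero : (∫ t, g t * F t) = 0 := by
    have hpt : ∀ t, g t * F t = 0 := by
      intro t
      by_cases ht : t ∈ Icc (-A) A
      · simp [hF t ht]
      · have : g t = 0 := image_eq_zero_of_notMem_tsupport (fun h' => ht (hgs h'))
        simp [this]
    simp [hpt]
  simpa [hzero] using hγ g hg

/-- OPENNESS IN THE ♯-CLASS (implicit-function form; plausibly provable: the defect on the thin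
annulus `A < |t| < A + ε` is an `L²` function of mass `→ 0`, the linearised synthesis
`δ ↦ (it) Σ_n δ_n e^{iγ_n t}` restricted to `(-A-ε, A+ε)` has a bounded right inverse because the
family contains uniformly discrete subsequences of arbitrarily large density (Beurling sampling), and
small smooth displacements keep `F` locally integrable). -/
def OpenSharp : Prop := ∀ A : ℝ, 0 < A → TraceSharp A → ∃ ε : ℝ, 0 < ε ∧ TraceSharp (A + ε)

/-- THE A-PRIORI ESTIMATE (where the Riemann hypothesis lives in this line): along the ladder the
collar energy of ♯-witnesses can be kept bounded. -/
def UniformCollar : Prop :=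
  ∀ A₁ R : ℝ, 0 < A₁ → A₁ < R → ∃ C : ℝ, ∀ A : ℝ, 0 < A → A ≤ A₁ → TraceSharp A →
    ∃ (γ : ℕ → ℝ) (F : ℝ → ℂ), IsPrimeSingular γ F ∧ (∀ t ∈ Icc (-A) A, F t = 0) ∧
      ∫ t in {t : ℝ | A < |t| ∧ |t| < R}, ‖F t‖ ^ 2 ≤ C

/-- CLOSEDNESS IN THE ♯-CLASS from the a-priori estimate (compactness + weak lower semicontinuity
of the collar energy). -/
def ClosedSharpOfCollar : Prop :=
  UniformCollar → ∀ A : ℝ, 0 < A → (∀ A' : ℝ, 0 < A' → A' < A → TraceSharp A') → TraceSharp A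

/-- ♯-frame: base in the ♯-class + IFT openness + a-priori collar bound + its closedness
consequence give X (same continuity method, then `windowCompactness_proof`). -/
theorem spectralThesis_of_sharp_continuity
    (hB : ∃ A₀ : ℝ, 0 < A₀ ∧ TraceSharp A₀) (hO : OpenSharp) (hU : UniformCollar)
    (hC : ClosedSharpOfCollar) : SpectralThesis := by
  have hall : ∀ A : ℝ, 0 < A → TraceSharp A := by
    intro A hA
    by_contra hnot
    obtain ⟨A₀, hA₀, hT₀⟩ := hB
    set S : Set ℝ := {x | 0 < x ∧ TraceSharp x} with hS
    have mono : ∀ {x y : ℝ}, x ≤ y → TraceSharp y → TraceSharp x := by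
      intro x y hxy ⟨γ, F, hγF, hF⟩
      exact ⟨γ, F, hγF, fun t ht => hF t (Icc_subset_Icc (by linarith) hxy ht)⟩
    have hmem₀ : A₀ ∈ S := ⟨hA₀, hT₀⟩
    have hne : S.Nonempty := ⟨A₀, hmem₀⟩
    have hbdd : ∀ x ∈ S, x ≤ A := by
      intro x hx
      by_contra hxA
      push Not at hxA
      exact hnot (mono hxA.le hx.2)
    have hBdd : BddAbove S := ⟨A, hbdd⟩
    have hs_pos : 0 < sSup S := lt_of_lt_of_le hA₀ (le_csSup hBdd hmem₀)
    have hTs : TraceSharp (sSup S) := by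
      refine hC hU (sSup S) hs_pos ?_
      intro A' _ hA'lt
      obtain ⟨x, hxS, hA'x⟩ := exists_lt_of_lt_csSup hne hA'lt
      exact mono hA'x.le hxS.2
    obtain ⟨ε, hε, hTε⟩ := hO (sSup S) hs_pos hTs
    have hle : sSup S + ε ≤ sSup S := le_csSup hBdd ⟨by linarith, hTε⟩
    linarith
  unfold SpectralThesis
  exact windowCompactness_proof (fun A hA => traceWin_of_traceSharp (hall A hA))

/-! ### Normal form (card `prime-singular-seed`): X as bounded correction of ONE seed -/

/-- Window correction of a given seed by a uniformly bounded displacement field. -/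
def SeedCorrection (γ : ℕ → ℝ) (A : ℝ) : Prop :=
  ∃ δ : ℕ → ℝ, (∃ C : ℝ, ∀ n, |δ n| ≤ C) ∧ ∀ g : ℝ → ℂ, IsWeilTest g → tsupport g ⊆ Icc (-A) A →
    HasSum (fun n => weilMellin g (1 / 2 + ((γ n + δ n : ℝ) : ℂ) * I)) (weilFunctional g)

/-- If one seed can be corrected on every window, X follows (each correction is a rung). -/
theorem spectralThesis_of_seedCorrection (γ : ℕ → ℝ) (h : ∀ A : ℝ, 0 < A → SeedCorrection γ A) :
    SpectralThesis := by
  unfold SpectralThesis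
  refine windowCompactness_proof (fun A hA => ?_)
  obtain ⟨δ, _, hδ⟩ := h A hA
  exact ⟨ℕ, fun n => γ n + δ n, fun g hg hgs => hδ g hg hgs⟩

/-! ### Strictness (card `window-continuity-method`, side lemma): a rung forces STRICT positivity -/

/-- For a window-`2a` family, `Re Q(g) = Σ_i |ĝ(1/2+iγ_i)|²` (tree: `hasSum_norm_sq_of_windowTrace`),
so `Re Q(g) = 0` forces the entire function `ĝ` of exponential type `≤ a` to vanish on a real set of
unbounded local density (`not_bounded_localCount_of_windowTrace`), hence `g = 0`: STRICT Weil
positivity on the half window. Typed; proof = Jensen/density for exponential type. -/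
def StrictPosOfTrace : Prop :=
  ∀ a : ℝ, 0 < a → TraceWin (2 * a) → ∀ g : ℝ → ℂ, IsWeilTest g → tsupport g ⊆ Icc (-a) a →
    g ≠ 0 → 0 < (weilQuadratic g).re

end Summit.RiemannHypothesis.RiemannHypothesis.Cruxes.SpectralThesis.Ideator2

end
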